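import Summits.CriticalPhenomena.PercolationContinuityZ3.Theorems.SahiMasterFamilyIndependentConjunction
import Summits.CriticalPhenomena.PercolationContinuityZ3.Theorems.PercNearOneGluingNoHeavyLowerTailSahiConjectureCubeFour
import Summits.CriticalPhenomena.PercolationContinuityZ3.Theorems.PercNearOneGluingNoHeavyLowerTailSahiC4CubeFiveAnyIndex
import HarnessLib

/-!
# `NoHeavyLowerTail` (crux stmt-CriticalPhenomena-4575), Sahi programme P4: the AND step at ROW LEVEL on cubes — Sahi's `E_{n+1} ≥ 0` for
# INTERSECTION-SEPARABLE families over ANY NUMBER of blocks (≤ 4 coins per block: every order; ≤ 5 coins per block: orders ≤ 4)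

Support file (cell `prim-l12`, seat P4, generation 33; `--supports stmt-CriticalPhenomena-4575`).  No definitions, no named facts, no sorries; the leaf
certificates (`NCopyCert.sahiPositive_bernoulliWeight_of_card_le_four`, `SahiC4Cube.sahiPositive_bernoulliWeight_of_card_le_five`) are computational upstream.

The tree's `SahiTotalCumulance.sahiE_separable_nonneg` (prim-masterthm P4) is the TWO-block AND step: it needs Sahi positivity of all orders `≤ n+1` of
BOTH block weights, so it does not iterate (the accumulated product cube is bigger than any certified leaf).  The row-level tensorisation
`SahiTotalCumulance.sahiE_prod_tensor_nonneg` needs, on the accumulated side, only the rows `E_{|S|} ≥ 0` of the SUB-FAMILIES of the given family — and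
sub-families of an intersection-separable family are intersection-separable.  Packaged with injective re-indexings (so that the conclusion has the same
shape as the hypothesis and the step ITERATES):

* `sahiE_interSeparable_rows_step` — blocks `ι₁` (arbitrary, any product weight) and `ι₂` (product weight Sahi-positive of orders `≤ n+1`); increasing
  `A_i ⊆ 2^{ι₁}`, `B_i ⊆ 2^{ι₂}` (`i < n+1`); IF every injectively re-indexed sub-family of `(1_{A_i})` has `E ≥ 0` under the `ι₁`-weight, THEN every
  injectively re-indexed sub-family of the separable family `(1_{A_i ⊠ B_i})`, `A ⊠ B = {ω : ω|ι₁ ∈ A, ω|ι₂ ∈ B}`, has `E ≥ 0` on `2^{ι₁ ⊔ ι₂}`.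
* `sahiE_interSeparable_rows_of_card_le_four` — base: one block of `≤ 4` coins (every order, tree `NCopyCert`).
* `sahiE_interSeparable_three_blocks_of_card_le_four` — worked iteration: three blocks of `≤ 4` coins, EVERY order `n+1`, every product measure:
  `E_{n+1}(1_{(A_i ⊠ B_i) ⊠ C_i}) ≥ 0` (twelve coins, all orders — outside every cube certificate in the tree); further blocks in the same way.
* `sahiE_interSeparable_three_blocks_of_card_le_five` — three blocks of `≤ 5` coins, orders `n+1 ≤ 4` (fifteen coins).
So: **Sahi's conjecture `E_k ≥ 0` [Sahi2008, Conj. 5] holds for every intersection-separable family `(⋂_j A_i^{(j)})_i` over any partition of the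
coordinates into blocks of `≤ 4` coins (every `k`) or `≤ 5` coins (`k ≤ 4`), under every product measure.**  HONEST FRAMING: an unconditional CLASS
(AND-gates only; the OR analogue at order 4 is generation-33 work in progress, seat memo); nothing is asserted about the conjecture in general. [this work]
-/

noncomputable section

namespace Summit.CriticalPhenomena.PercolationContinuityZ3.Theorems.SahiE4UnionTensor

open Finset Function Literature.Combinatorics.Sahi2008
open Literature.Probability.Percolation.DecisionTree (ind ind_of_mem ind_of_not_mem ind_nonneg)
open Summit.CriticalPhenomena.PercolationContinuityZ3.Theorems.SahiTotalCumulance (glue pushWeight_glue ind_separable_comp_glue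
  sahiE_prod_tensor_nonneg)

section Step

variable {ι₁ ι₂ : Type} [Fintype ι₁] [Fintype ι₂]

/-- **Row-level AND step on cubes, iterable form.**  `ι₁` arbitrary with any product weight; `ι₂` with a product weight Sahi-positive of all orders
`≤ n+1`; events `A_i ⊆ 2^{ι₁}` (no monotonicity needed on the accumulated side) and increasing `B_i ⊆ 2^{ι₂}`.  If every injectively re-indexed sub-family of `(1_{A_i})_i` has nonnegative Sahi functional
under the `ι₁`-weight, then so has every injectively re-indexed sub-family of the intersection-separable family `(1_{A_i ⊠ B_i})_i` on `2^{ι₁ ⊔ ι₂}`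
(engine: `SahiTotalCumulance.sahiE_prod_tensor_nonneg`, the law of total cumulance). [this work] -/
theorem sahiE_interSeparable_rows_step (p₁ : ι₁ → unitInterval) (p₂ : ι₂ → unitInterval) (n : ℕ)
    (A : Fin (n + 1) → Set (Set ι₁)) (B : Fin (n + 1) → Set (Set ι₂)) (hB : ∀ i, IsUpperSet (B i))
    (hEA : ∀ (m : ℕ) (e : Fin m → Fin (n + 1)), Injective e → 0 ≤ sahiE (bernoulliWeight p₁) m (fun j => ind (A (e j))))
    (h₂ : ∀ L ≤ n + 1, SahiPositive (bernoulliWeight p₂) L) :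
    ∀ (m : ℕ) (e : Fin m → Fin (n + 1)), Injective e →
      0 ≤ sahiE (bernoulliWeight (Sum.elim p₁ p₂)) m
        (fun j => ind {ω : Set (ι₁ ⊕ ι₂) | Sum.inl ⁻¹' ω ∈ A (e j) ∧ Sum.inr ⁻¹' ω ∈ B (e j)}) := by
  intro m e he
  cases m with
  | zero => rw [sahiE_zero]
  | succ m' =>
    have hm : m' + 1 ≤ n + 1 := by
      have := Fintype.card_le_of_injective e he
      simpa [Fintype.card_fin] using this
    rw [← pushWeight_glue, sahiE_pushWeight]
    have hfam : (fun j => (ind {ω : Set (ι₁ ⊕ ι₂) | Sum.inl ⁻¹' ω ∈ A (e j) ∧ Sum.inr ⁻¹' ω ∈ B (e j)}) ∘ glue) =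
        fun j (q : Set ι₁ × Set ι₂) => ind (A (e j)) q.1 * ind (B (e j)) q.2 := by
      funext j
      exact ind_separable_comp_glue (A (e j)) (B (e j))
    rw [hfam]
    refine sahiE_prod_tensor_nonneg (bernoulliWeight p₁) (bernoulliWeight p₂) m' (fun j => ind (A (e j))) (fun j => ind (B (e j)))
      (fun S => ?_) (fun L hL => h₂ L (le_trans hL hm)) (fun i y => ind_nonneg _ _) (fun i => SahiTotalCumulance.monotone_ind_of_isUpperSet (hB (e i)))
    exact hEA S.card (fun j => e (S.orderEmbOfFin rfl j)) (he.comp (S.orderEmbOfFin rfl).injective)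

/-- **Base of the iteration**: a single block of at most four coins — every injectively re-indexed sub-family of increasing events has `E ≥ 0`
under any product weight (tree: `NCopyCert.sahiPositive_bernoulliWeight_of_card_le_four`, all orders). [this work] -/
theorem sahiE_rows_of_card_le_four (hι₁ : Fintype.card ι₁ ≤ 4) (p₁ : ι₁ → unitInterval) {N : ℕ} (A : Fin N → Set (Set ι₁))
    (hA : ∀ i, IsUpperSet (A i)) :
    ∀ (m : ℕ) (e : Fin m → Fin N), Injective e → 0 ≤ sahiE (bernoulliWeight p₁) m (fun j => ind (A (e j))) :=
  fun m e _ => NCopyCert.sahiPositive_bernoulliWeight_of_card_le_four hι₁ p₁ m _ (fun j x => ind_nonneg (A (e j)) x)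
    fun j => SahiTotalCumulance.monotone_ind_of_isUpperSet (hA (e j))

omit [Fintype ι₁] [Fintype ι₂] in
/-- An intersection-separable event built from increasing events is increasing. [this work] -/
theorem isUpperSet_interSeparable {A : Set (Set ι₁)} {B : Set (Set ι₂)} (hA : IsUpperSet A) (hB : IsUpperSet B) :
    IsUpperSet {ω : Set (ι₁ ⊕ ι₂) | Sum.inl ⁻¹' ω ∈ A ∧ Sum.inr ⁻¹' ω ∈ B} := by
  intro ω ω' hle h
  exact ⟨hA (Set.preimage_mono hle) h.1, hB (Set.preimage_mono hle) h.2⟩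

/-- **Two blocks of at most four coins, every order, with the iterable conclusion** (all re-indexed sub-families). [this work] -/
theorem sahiE_interSeparable_rows_of_card_le_four (hι₁ : Fintype.card ι₁ ≤ 4) (hι₂ : Fintype.card ι₂ ≤ 4)
    (p₁ : ι₁ → unitInterval) (p₂ : ι₂ → unitInterval) (n : ℕ)
    (A : Fin (n + 1) → Set (Set ι₁)) (B : Fin (n + 1) → Set (Set ι₂)) (hA : ∀ i, IsUpperSet (A i)) (hB : ∀ i, IsUpperSet (B i)) :
    ∀ (m : ℕ) (e : Fin m → Fin (n + 1)), Injective e →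
      0 ≤ sahiE (bernoulliWeight (Sum.elim p₁ p₂)) m
        (fun j => ind {ω : Set (ι₁ ⊕ ι₂) | Sum.inl ⁻¹' ω ∈ A (e j) ∧ Sum.inr ⁻¹' ω ∈ B (e j)}) :=
  sahiE_interSeparable_rows_step p₁ p₂ n A B hB (sahiE_rows_of_card_le_four hι₁ p₁ A hA)
    fun L _ => NCopyCert.sahiPositive_bernoulliWeight_of_card_le_four hι₂ p₂ L

/-- **Three blocks of at most four coins, EVERY order**: on `2^{(ι₁ ⊔ ι₂) ⊔ ι₃}` with `|ι₁|, |ι₂|, |ι₃| ≤ 4` and any product measure, for increasing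
block events `A_i, B_i, C_i` the intersection-separable family `((A_i ⊠ B_i) ⊠ C_i)_{i<n+1}` has `E_{n+1} ≥ 0` — twelve coins, all orders; and the
conclusion is again in iterable form, so further blocks are added in the same way. [this work] -/
theorem sahiE_interSeparable_three_blocks_of_card_le_four {ι₃ : Type} [Fintype ι₃]
    (hι₁ : Fintype.card ι₁ ≤ 4) (hι₂ : Fintype.card ι₂ ≤ 4) (hι₃ : Fintype.card ι₃ ≤ 4)
    (p₁ : ι₁ → unitInterval) (p₂ : ι₂ → unitInterval) (p₃ : ι₃ → unitInterval) (n : ℕ)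
    (A : Fin (n + 1) → Set (Set ι₁)) (B : Fin (n + 1) → Set (Set ι₂)) (C : Fin (n + 1) → Set (Set ι₃))
    (hA : ∀ i, IsUpperSet (A i)) (hB : ∀ i, IsUpperSet (B i)) (hC : ∀ i, IsUpperSet (C i)) :
    ∀ (m : ℕ) (e : Fin m → Fin (n + 1)), Injective e →
      0 ≤ sahiE (bernoulliWeight (Sum.elim (Sum.elim p₁ p₂) p₃)) m
        (fun j => ind {ω : Set ((ι₁ ⊕ ι₂) ⊕ ι₃) |
          Sum.inl ⁻¹' ω ∈ {ω' : Set (ι₁ ⊕ ι₂) | Sum.inl ⁻¹' ω' ∈ A (e j) ∧ Sum.inr ⁻¹' ω' ∈ B (e j)} ∧ Sum.inr ⁻¹' ω ∈ C (e j)}) :=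
  sahiE_interSeparable_rows_step (Sum.elim p₁ p₂) p₃ n
    (fun i => {ω' : Set (ι₁ ⊕ ι₂) | Sum.inl ⁻¹' ω' ∈ A i ∧ Sum.inr ⁻¹' ω' ∈ B i}) C hC
    (sahiE_interSeparable_rows_of_card_le_four hι₁ hι₂ p₁ p₂ n A B hA hB)
    fun L _ => NCopyCert.sahiPositive_bernoulliWeight_of_card_le_four hι₃ p₃ L

/-- **Three blocks of at most five coins, orders `≤ 4`**: on `2^{(ι₁ ⊔ ι₂) ⊔ ι₃}` with `|ι_j| ≤ 5` and any product measure, intersection-separable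
families of `n + 1 ≤ 4` increasing block events have `E_{n+1} ≥ 0` — fifteen coins (leaf: `C₄` on five coins, computational). [this work] -/
theorem sahiE_interSeparable_three_blocks_of_card_le_five {ι₃ : Type} [Fintype ι₃]
    (hι₁ : Fintype.card ι₁ ≤ 5) (hι₂ : Fintype.card ι₂ ≤ 5) (hι₃ : Fintype.card ι₃ ≤ 5)
    (p₁ : ι₁ → unitInterval) (p₂ : ι₂ → unitInterval) (p₃ : ι₃ → unitInterval) (n : ℕ) (hn : n + 1 ≤ 4)
    (A : Fin (n + 1) → Set (Set ι₁)) (B : Fin (n + 1) → Set (Set ι₂)) (C : Fin (n + 1) → Set (Set ι₃))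
    (hA : ∀ i, IsUpperSet (A i)) (hB : ∀ i, IsUpperSet (B i)) (hC : ∀ i, IsUpperSet (C i)) :
    ∀ (m : ℕ) (e : Fin m → Fin (n + 1)), Injective e →
      0 ≤ sahiE (bernoulliWeight (Sum.elim (Sum.elim p₁ p₂) p₃)) m
        (fun j => ind {ω : Set ((ι₁ ⊕ ι₂) ⊕ ι₃) |
          Sum.inl ⁻¹' ω ∈ {ω' : Set (ι₁ ⊕ ι₂) | Sum.inl ⁻¹' ω' ∈ A (e j) ∧ Sum.inr ⁻¹' ω' ∈ B (e j)} ∧ Sum.inr ⁻¹' ω ∈ C (e j)}) := by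
  have base : ∀ (m : ℕ) (e : Fin m → Fin (n + 1)), Injective e → 0 ≤ sahiE (bernoulliWeight p₁) m (fun j => ind (A (e j))) := by
    intro m e he
    have hm : m ≤ 4 := by
      have := Fintype.card_le_of_injective e he
      simp only [Fintype.card_fin] at this
      omega
    exact SahiC4Cube.sahiPositive_bernoulliWeight_of_card_le_five hι₁ p₁ hm _ (fun j x => ind_nonneg (A (e j)) x)
      fun j => SahiTotalCumulance.monotone_ind_of_isUpperSet (hA (e j))
  have two := sahiE_interSeparable_rows_step p₁ p₂ n A B hB base
    fun L hL => SahiC4Cube.sahiPositive_bernoulliWeight_of_card_le_five hι₂ p₂ (le_trans hL hn)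
  exact sahiE_interSeparable_rows_step (Sum.elim p₁ p₂) p₃ n
    (fun i => {ω' : Set (ι₁ ⊕ ι₂) | Sum.inl ⁻¹' ω' ∈ A i ∧ Sum.inr ⁻¹' ω' ∈ B i}) C hC two
    fun L hL => SahiC4Cube.sahiPositive_bernoulliWeight_of_card_le_five hι₃ p₃ (le_trans hL hn)

end Step

end Summit.CriticalPhenomena.PercolationContinuityZ3.Theorems.SahiE4UnionTensor

end
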